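import Mathlib

/-!
# The power criterion behind ENGINE v15 'L2RES' (HodgeConjecture / FermatCycles cell, ftc-engine gen-18)

HONEST FRAMING: explicit algebraic cycles for specific Hodge classes on Fermat/Delsarte varieties;
residual open instances listed; no claim on general Hodge.

The exact search of the closed curve-contact condition in `code/ftc/l2res/stagec.py` (memo
`ftc/certs/W69/L2RES.md` §1 (d)) decides whether a binary form `R` is a constant times an
`m`-th power, `R = c • S ^ m`, through the LINEAR condition on the unknown `S`
`m • R • S' = R' • S`.  The direction used for every EMPTY verdict is the necessity of that
condition: if `R = C c * S ^ m` then `m • R • S' - R' • S = 0` identically.  This file records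
that identity over an arbitrary commutative ring (so in particular over the prime fields and
their extensions used by the engine); nothing else of the engine is formalised here.
-/

namespace Summit.HodgeConjecture.FermatCycles.PowerRootCriterion

open Polynomial

/-- Necessity of the power criterion: for `R = C c * S ^ (n + 1)` the form
`(n + 1) • R • S' - R' • S` vanishes identically (as polynomials). -/
theorem power_criterion {K : Type*} [CommRing K] (c : K) (S : K[X]) (n : ℕ) :
    C ((n + 1 : ℕ) : K) * (C c * S ^ (n + 1)) * derivative S
      - derivative (C c * S ^ (n + 1)) * S = 0 := by
  rw [derivative_mul, derivative_C, zero_mul, zero_add, derivative_pow, Nat.add_sub_cancel]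
  push_cast
  ring

/-- The same identity with the power written as `m` (for `m = 0` both sides are trivially `0`). -/
theorem power_criterion' {K : Type*} [CommRing K] (c : K) (S : K[X]) (m : ℕ) :
    C ((m : ℕ) : K) * (C c * S ^ m) * derivative S - derivative (C c * S ^ m) * S = 0 := by
  cases m with
  | zero => simp
  | succ n =>
    simpa using power_criterion c S n

end Summit.HodgeConjecture.FermatCycles.PowerRootCriterion
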